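import Mathlib

/-!
# `Balaban1983to89.B14Def2Ek` — CMP 119 §2 p. 262 / §3 p. 279: the vacuum-energy constants `E_k` WITH BODY — `E_k` is the
# initial constant `E` minus the one-step vacuum energy expressions generated so far, the recursion
# `−E_k + E^{(k)} = −E_{k+1}` of p. 279, and `E` itself as the sum of all such expressions for the full lattices

statement-level skeleton of published theorems with citation tags; proofs where landed; nothing here is a claim about the Yang–Mills mass gap

CITATION HEADER (lean-in-tree rule).  Source: T. Bałaban, *Convergent renormalization expansions for lattice gauge
theories*, Commun. Math. Phys. **119**, 243–285 (1988), doi:10.1007/bf01217741 [Balaban1988Convergent] (cell paper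
B14 = «[III]»; held `paper:balaban1988-cmp119-convergent-renormalization`, journal page = PDF page + 242; pp. 254, 262,
279 read on the text layer `p0012`, `p0020`, `p0037`).  Mega-formalization `lit-balaban`, unit `lit-balaban-r11` (CMP 119,
B14 fold owner), SKELETON row **B14.Def§2.Ek** (neighbours B14.Eq1.28–1.30 = `E₁`, B14.Def§3.p279 = the inductive
definition of the new terms, B14.Eq0.2 = the Wilson start `exp[−(1/g₀²)A − E]`).

THE PRINTED TEXT (verbatim).  p. 262 [PDF 20]: *"The constant E_k (depending on {Ω_j}, {Λ_j} also) is obtained by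
subtracting one-step vacuum energy expressions, generated in small field regions, from the initial constant E. This
initial constant is defined in fact as a sum of all such expressions for all the lattices T^{(k)} as the small field
regions. The constant E₁ was defined in Sect. 1, and a general inductive definition will be given in the next section."*
p. 279 [PDF 37]: *"The vacuum energy renormalization is performed by subtracting the values of E^{(k+1)} and R″^{(k+1)} at
the configuration U_{k+1} = 1 from the corresponding terms, and adding these values to E₀^{(k)}. This yields the term
E^{(k)}, and we define −E_k + E^{(k)} = −E_{k+1}."*  p. 254 [PDF 12] ((1.30)): *"The constant E₁ is obtained from E by
subtraction of all the constants which have appeared in the procedure, i.e., the constants in the first exponential in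
(1.15), and the constant 𝐄^{(1)}(Λ₁, g₀, 1). Thus E₁ depends on Ω₁, Λ₁."*  (In this file the datum `e 0` stands for the
SUM of those constants of the first step — the constants `log g₀ d(𝐠)|Ω₁*| + log σ₀|Ω₁*| − log z(L⁴−1)|Ω₁^{(1)}|` of the first
exponential in (1.15) and `𝐄^{(1)}(Λ₁, g₀, 1)`.)

v1.1 (r11 gen 100, literature-prover-lit-balaban-r11-g100-0): DOCSTRING-ONLY — referee ref-5 D-g78-1 (zero weight): the
p. 254 sentence is now quoted in full here and at `Ek_one` (v1.0 cut it after «in the procedure» without an ellipsis at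
`Ek_one`); no declaration changed.

THE DATA (READING RULE (a): printed objects as parameters).  `e : ℕ → ℝ`, `e k = E^{(k)}` = the one-step vacuum energy
expression generated in the small field region at the `(k+1)`-st step (its construction is §3 p. 279 / (3.47), row
B14.Def§3.p279; it depends on `{Ω_j}, {Λ_j}` through the domains of that step — here a datum); `E : ℝ` the initial
constant; for `Einit`, `eFull k` = the same expression with the whole lattice `T^{(k)}` as the small field region.

WHAT IS TYPED / PROVED (0 `sorry`; two `ℝ`-valued definitions with bodies + theorems; no `Prop`-def).
* **`Ek E e k`** — `E_k` by the printed recursion `E₀ = E`, `E_{k+1} = E_k − E^{(k)}`; `Ek_zero`, **`Ek_succ`**, the printed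
  form **`neg_Ek_add`** (`−E_k + E^{(k)} = −E_{k+1}`), **`Ek_eq_sub_sum`** (*"obtained by subtracting [the] one-step vacuum
  energy expressions … from the initial constant E"*: `E_k = E − Σ_{j<k} E^{(j)}`), `Ek_one` ((1.30): `E₁ = E − E^{(0)}`).
* **`Einit eFull K`** — *"This initial constant is defined in fact as a sum of all such expressions for all the lattices
  T^{(k)} as the small field regions"*: `E = Σ_{k<K} eFull k`; consequence `Ek_Einit_self` (with no large fields at all the
  constant is exhausted on the unit lattice: `E_K = 0`) and `Ek_Einit` (in general `E_K = Σ_{k<K} (eFull k − e k)`, the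
  vacuum energy NOT generated because of the large field regions).

NOT ASSERTED: the construction or any bound of the expressions `E^{(k)}` (rows B14.Def§3.p279, B14.Eq3.47, B14.Thm2).

## References
* [Balaban1988Convergent] T. Bałaban, Commun. Math. Phys. 119 (1988) 243–285, §2 p. 262, §3 p. 279, (1.30) p. 254.
-/

namespace Literature.MathematicalPhysics.QuantumFieldTheory.Balaban1983to89.B14.Def2Ek

open Finset

/-- **`E_k`** (p. 262 / p. 279): `E₀ = E` and `E_{k+1} = E_k − E^{(k)}` (*"we define −E_k + E^{(k)} = −E_{k+1}"*), `e k =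
E^{(k)}` the one-step vacuum energy expression of the `(k+1)`-st step. [cite: Balaban1988Convergent, §2 p.262, §3 p.279] -/
def Ek (E : ℝ) (e : ℕ → ℝ) : ℕ → ℝ
  | 0 => E
  | k + 1 => Ek E e k - e k

/-- `E₀ = E` (the constant of the Wilson start `ρ₀ = exp[−(1/g₀²)A − E]`). [cite: Balaban1988Convergent, §2 p.262] -/
@[simp] theorem Ek_zero (E : ℝ) (e : ℕ → ℝ) : Ek E e 0 = E := rfl

/-- The step `E_{k+1} = E_k − E^{(k)}`. [cite: Balaban1988Convergent, §3 p.279] -/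
theorem Ek_succ (E : ℝ) (e : ℕ → ℝ) (k : ℕ) : Ek E e (k + 1) = Ek E e k - e k := rfl

/-- **p. 279 as printed: `−E_k + E^{(k)} = −E_{k+1}`.** [cite: Balaban1988Convergent, §3 p.279] -/
theorem neg_Ek_add (E : ℝ) (e : ℕ → ℝ) (k : ℕ) : -Ek E e k + e k = -Ek E e (k + 1) := by
  rw [Ek_succ]; ring

/-- **p. 262: `E_k` "is obtained by subtracting one-step vacuum energy expressions … from the initial constant E"**:
`E_k = E − Σ_{j<k} E^{(j)}`. [cite: Balaban1988Convergent, §2 p.262] -/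
theorem Ek_eq_sub_sum (E : ℝ) (e : ℕ → ℝ) : ∀ k : ℕ, Ek E e k = E - ∑ j ∈ range k, e j
  | 0 => by simp
  | k + 1 => by rw [Ek_succ, Ek_eq_sub_sum E e k, sum_range_succ]; ring

/-- (1.30) p. 254: *"The constant E₁ is obtained from E by subtraction of all the constants which have appeared in the
procedure, i.e., the constants in the first exponential in (1.15), and the constant 𝐄^{(1)}(Λ₁, g₀, 1). Thus E₁ depends on
Ω₁, Λ₁."* — `E₁ = E − E^{(0)}`, the datum `e 0 = E^{(0)}` standing for the sum of those first-step constants.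
[cite: Balaban1988Convergent, (1.30) p.254] -/
theorem Ek_one (E : ℝ) (e : ℕ → ℝ) : Ek E e 1 = E - e 0 := by
  rw [Ek_eq_sub_sum]; simp

/-- `E_k` depends on the expressions of the steps `< k` only (so on `{Ω_j}, {Λ_j}`, `j ≤ k`, through them).
[cite: Balaban1988Convergent, §2 p.262] -/
theorem Ek_congr (E : ℝ) {e e' : ℕ → ℝ} {k : ℕ} (h : ∀ j, j < k → e j = e' j) : Ek E e k = Ek E e' k := by
  rw [Ek_eq_sub_sum, Ek_eq_sub_sum]
  exact congrArg _ (sum_congr rfl fun j hj => h j (mem_range.mp hj))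

/-- **The initial constant `E`** (p. 262): *"defined in fact as a sum of all such expressions for all the lattices T^{(k)}
as the small field regions"* — `E = Σ_{k<K} eFull k`, `eFull k` the one-step expression of the `(k+1)`-st step with the
whole lattice as the small field region, `K` the number of steps (unit lattice `T^{(K)}`). [cite: Balaban1988Convergent, §2 p.262] -/
def Einit (eFull : ℕ → ℝ) (K : ℕ) : ℝ := ∑ k ∈ range K, eFull k

/-- Unfolding of `Einit`. [cite: Balaban1988Convergent, §2 p.262] -/
theorem Einit_succ (eFull : ℕ → ℝ) (K : ℕ) : Einit eFull (K + 1) = Einit eFull K + eFull K := by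
  simp [Einit, sum_range_succ]

/-- In general `E_K = Σ_{k<K} (eFull k − E^{(k)})`: what is left of `E` on the unit lattice is the vacuum energy NOT
generated in the small field regions (because of the large field regions). [cite: Balaban1988Convergent, §2 p.262] -/
theorem Ek_Einit (eFull e : ℕ → ℝ) (K : ℕ) : Ek (Einit eFull K) e K = ∑ k ∈ range K, (eFull k - e k) := by
  rw [Ek_eq_sub_sum, Einit, sum_sub_distrib]

/-- With no large fields at all (`E^{(k)} = eFull k` at every step) the constant is exhausted on the unit lattice:
`E_K = 0`. [cite: Balaban1988Convergent, §2 p.262] -/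
theorem Ek_Einit_self (eFull : ℕ → ℝ) (K : ℕ) : Ek (Einit eFull K) eFull K = 0 := by
  rw [Ek_Einit]; simp

end Literature.MathematicalPhysics.QuantumFieldTheory.Balaban1983to89.B14.Def2Ek
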